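import Summits.CriticalPhenomena.PercolationContinuityZ3.Theorems.Transplant.PlanarSkeletonFrmFromDefs
import Summits.CriticalPhenomena.PercolationContinuityZ3.Theorems.Transplant.CayleySkeletonFrm
import Summits.CriticalPhenomena.PercolationContinuityZ3.Theorems.Transplant.CayleySkeletonFrom
import HarnessLib

/-!
# `CayleyFrm₃` — INPUT(Cay(Γ;S)) = (φ, finitely generated kernel) and NOTHING ELSE, modulo the universal one-type node

builds on p205010 (kernel theorem, internal audit signed; external expert review pending) — nothing in this file uses p205010.  The percolation
conclusions are CONDITIONAL on the OPEN node `SamePDropOfSkeletonFrmFrom₁` (file `PlanarSkeletonFrmFromDefs`; hypothesis `hN`, nothing claimed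
about it); Φ2 (`cylSubcritical_of_le'`) is unconditional.  Lane `prim-bschramm`, seat `prim-bschramm-p4` gen 13 (PART C3 of `P4-GENERAL.md`
§35).  Helper file (`--supports stmt-CriticalPhenomena-4575 --as helper`).

WHAT.  Gen 12's `CayleyNeg₃` = (φ additive unit range with unit steps, ONE reversing automorphism ν, `ker φ` generated by kernel elements of
bounded `S`-length) serves D″(κ′); gen 13's `CayleyFrm₂` = (φ, `C_1` connected) serves N2.  Their meet:
* §1 **`CayleyFrm₃ Γ S`** := `CayleyNeg₃` minus `ν` = `(φ, r, ker φ = ⟨kernel elements of length ≤ r⟩)` — the finitely-generated-kernel criterion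
  ("SOME cylinder connected", gen 11 telescoping) with NO symmetry; `skeletonFrmFrom : PlanarSkeletonFrmFrom (Cay(Γ;S))` (one type, `ℓ₀ = r`);
  **Φ2 for EVERY width, UNCONDITIONAL** (`cylSubcritical_of_le'`, thick frames); **`CayleyFrm₃.theta_eq_zero_of_le_of_frmFromNode₁ :
  SamePDropOfSkeletonFrmFrom₁ → ∀ g, ∀ p ≤ p_c, θ_g(p) = 0`**; constructors `ofNeg₃` (drop ν), `ofFrm₂` (`C_1` connected ⟹ radius 5), `ofGens`
  (explicit finite kernel generating set, `S` generating).
* sequel `CayleyNilpotentFrmFrom`: `NilFrm.Data` — every f.g. nilpotent group with ANY unit-range alphabet is a `CayleyFrm₃` (kernel f.g. via the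
  companion alphabet), the end state of the C3 class map at the Cayley level: INPUT = (φ), modulo the universal node.
What is NOT covered even then: generating sets with no unit-range rank-2 chart with unit steps (tall presentations: multi-type carriers, §35.6),
`b₁ ≤ 1` (no chart), site versions.
[cite: BenjaminiSchramm1996, Conj. 4; §2 (Cayley graphs)] [cite: KozmaNitzan2024, §1 p. 2 (approach 1); §4 p. 16 (Lemma 8)]
[cite: AizenmanGrimmett1991, Thm 1 (essential enhancements)]
-/

noncomputable section

namespace Summit.CriticalPhenomena.PercolationContinuityZ3.Theorems.Transplant

open SimpleGraph Walk Subgroup Literature.Probability.LatticeModels Literature.Probability.Percolation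
open Literature.Barriers.CriticalPhenomena (countable_of_connected_of_locallyFinite)
open scoped commutatorElement Classical

/-! ## §1 The datum, its skeleton, Φ2, the conditional theorem -/

/-- **INPUT, frames-only version, finitely-generated-kernel criterion**: additive `φ : Γ → ℤ²` of unit range on `S` with unit steps in `S`, and
`ker φ` generated by the kernel elements of the ball of radius `r` of `Cay(Γ;S)` — NO automorphism (`CayleyNeg₃` without `ν`).
[cite: KozmaNitzan2024, §4 p. 16 (Lemma 8)] [cite: BenjaminiSchramm1996, §2; Conj. 4] -/
structure CayleyFrm₃ (Γ : Type) [Group Γ] (S : Finset Γ) where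
  /-- the skeleton -/
  φ : Γ → Site 2
  /-- additivity -/
  map_mul : ∀ g h : Γ, φ (g * h) = φ g + φ h
  /-- unit range on `S` -/
  lip : ∀ s ∈ S, ∀ i : Fin 2, |φ s i| ≤ 1
  /-- unit steps in `S` -/
  step : ∀ i : Fin 2, ∃ s ∈ S, φ s = Pi.single i 1
  /-- the radius -/
  r : ℕ
  /-- the kernel is generated by the kernel elements of length `≤ r` -/
  ker_short : ∀ k : Γ, φ k = 0 → k ∈ Subgroup.closure (CayCyl.shortKer φ S r)

namespace CayleyFrm₃

variable {Γ : Type} [Group Γ] {S : Finset Γ} (C : CayleyFrm₃ Γ S)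

/-- The base datum. [folklore] -/
def base : CayCyl.CylBase Γ S where
  φ := C.φ
  map_mul := C.map_mul
  lip := C.lip
  s₀ := Classical.choose (C.step 0)
  s₀_mem := (Classical.choose_spec (C.step 0)).1
  φ_s₀ := (Classical.choose_spec (C.step 0)).2
  s₁ := Classical.choose (C.step 1)
  s₁_mem := (Classical.choose_spec (C.step 1)).1
  φ_s₁ := (Classical.choose_spec (C.step 1)).2

/-- The `CylData₂` of the datum (radius `r`). [folklore] -/
def cylData₂ : CayCyl.CylData₂ Γ S where
  toCylBase := C.base
  r := C.r
  ker_short := C.ker_short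

/-- `φ 1 = 0`. [folklore] -/
theorem φ_one : C.φ 1 = 0 := C.base.φ_one

include C in
/-- **Every vertex of `Cay(Γ;S)` is joined to `1`** (it lies in a wide enough connected cylinder together with `1`). [folklore] -/
theorem reachable_one (a : Γ) : (mulCayley (S : Set Γ)).Reachable a 1 := by
  set L : ℕ := C.r + (C.φ a 0).natAbs + (C.φ a 1).natAbs with hL
  have ha : a ∈ C.cylData₂.enl.V L := by
    rw [CayCyl.CylData.memV, abs_le, abs_le]
    show (-(L : ℤ) ≤ C.φ a 0 ∧ C.φ a 0 ≤ L) ∧ (-(L : ℤ) ≤ C.φ a 1 ∧ C.φ a 1 ≤ L)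
    omega
  have h1 : (1 : Γ) ∈ C.cylData₂.enl.V L := C.cylData₂.one_mem_VE L
  exact ((C.cylData₂.cylG_connected_of_le (show C.cylData₂.r ≤ L by show C.r ≤ L; omega)).preconnected ⟨a, ha⟩ ⟨1, h1⟩).map
    (Embedding.induce _).toHom

include C in
/-- `Cay(Γ;S)` is connected for a `CayleyFrm₃`. [folklore] -/
theorem connected_cay : (mulCayley (S : Set Γ)).Preconnected ∧ Nonempty Γ :=
  ⟨fun a b => (C.reachable_one a).trans (C.reachable_one b).symm, ⟨1⟩⟩

/-- **THE ONE-TYPE FRAMES-ONLY SKELETON WITH CYLINDERS CONNECTED FROM WIDTH `r` ON of `Cay(Γ; S)`**: base vertex `1`, frames = left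
translations, degree bound `2|S|`, unit steps, (κ′) with `ℓ₀ = r`, no point symmetry. [cite: KozmaNitzan2024, §4 p. 16 (Lemma 8)] -/
def skeletonFrmFrom : PlanarSkeletonFrmFrom (mulCayley (S : Set Γ)) where
  φ := C.φ
  lip := fun _ _ h i => by rw [abs_sub_comm]; exact C.base.lip_adj h i
  types := {1}
  frame := fun v => ⟨1, Finset.mem_singleton_self 1, leftMulIso S v, mul_one v, fun w => by
    show C.φ (v * w) = C.φ w + (C.φ v - C.φ 1)
    rw [C.map_mul, φ_one, sub_zero, add_comm]⟩
  Δ := 2 * S.card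
  degree_le := degree_mulCayley_le S
  step := fun v i σ => by
    obtain ⟨s, hs, hφ⟩ := C.step i
    have hs1 : s ≠ 1 := by
      intro h
      have h0 := congrFun hφ i
      rw [h, φ_one] at h0
      simp at h0
    rcases Int.units_eq_one_or σ with rfl | rfl
    · exact ⟨v * s, CayCyl.adj_mul_of_mem S (Or.inl hs) hs1 v, by rw [C.map_mul, hφ, Units.val_one]⟩
    · refine ⟨v * s⁻¹, CayCyl.adj_mul_of_mem S (Or.inr (by rw [inv_inv]; exact hs)) (inv_ne_one.2 hs1) v, ?_⟩
      rw [C.map_mul, show C.φ s⁻¹ = -C.φ s from C.base.φ_inv s, hφ, Units.val_neg, Units.val_one, Pi.single_neg]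
  ℓ₀ := C.r
  cyl_connected := fun t ht ℓ hℓ => by
    rw [Finset.mem_singleton] at ht
    subst ht
    have e : {w | C.φ w - C.φ 1 ∈ box 2 ℓ} = C.cylData₂.enl.V ℓ := by
      ext w; simp [CayCyl.CylData.V, cylData₂, base, CayCyl.CylData₂.enl, φ_one]
    rw [e]
    exact C.cylData₂.cylG_connected_of_le hℓ

/-- The skeleton has the single base type `1`. [folklore] -/
@[simp] theorem skeletonFrmFrom_types : C.skeletonFrmFrom.types = {1} := rfl

/-- The skeleton map is `φ`. [folklore] -/
@[simp] theorem skeletonFrmFrom_φ : C.skeletonFrmFrom.φ = C.φ := rfl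

/-- **Φ2 AT AND BELOW `p_c` FOR EVERY `CayleyFrm₃`, EVERY WIDTH (UNCONDITIONAL)**: for `p ≤ p_c(Cay(Γ;S))` no cylinder of the skeleton
percolates at `p` (thick frames: `p_c ≤ p_c(C_{ℓ+2r+1}) < p_c(C_ℓ)` or `p_c(C_ℓ) = 1`). [cite: AizenmanGrimmett1991, Thm 1 (essential enhancements)] -/
theorem cylSubcritical_of_le' {p : unitInterval} (hp : (p : ℝ) ≤ criticalProb (mulCayley (S : Set Γ)) (1 : Γ)) :
    C.skeletonFrmFrom.CylSubcritical p := by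
  intro t ht ℓ
  change t ∈ ({1} : Finset Γ) at ht
  rw [Finset.mem_singleton] at ht
  subst ht
  have hc : (mulCayley (S : Set Γ)).Connected := (connected_iff _).2 C.connected_cay
  haveI : Countable Γ := countable_of_connected_of_locallyFinite _ hc 1
  have e : {w | C.skeletonFrmFrom.φ w - C.skeletonFrmFrom.φ 1 ∈ box 2 ℓ} = C.cylData₂.enl.V ℓ := by
    ext w; simp [CayCyl.CylData.V, cylData₂, base, CayCyl.CylData₂.enl, skeletonFrmFrom, φ_one]
  show theta ((mulCayley (S : Set Γ)).induce {w | C.skeletonFrmFrom.φ w - C.skeletonFrmFrom.φ 1 ∈ box 2 ℓ}) ⟨1, _⟩ _ = 0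
  rw [theta_induce_congr _ e]
  have h0 := C.cylData₂.theta_cyl_criticalProb_eq_zeroE (C.skeletonFrmFrom.criticalProb_lt_one_frmFrom hc 1) ℓ
  have hmono : theta (C.cylData₂.cylG ℓ) ⟨1, C.cylData₂.one_mem_VE ℓ⟩ p ≤
      theta (C.cylData₂.cylG ℓ) ⟨1, C.cylData₂.one_mem_VE ℓ⟩ (criticalProbIOf (mulCayley (S : Set Γ)) (1 : Γ)) :=
    theta_mono_holds _ _ (Subtype.coe_le_coe.mp hp)
  have hnn : 0 ≤ theta (C.cylData₂.cylG ℓ) ⟨1, C.cylData₂.one_mem_VE ℓ⟩ p := MeasureTheory.measureReal_nonneg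
  linarith

include C in
/-- **CONDITIONAL THEOREM (the end of the Cayley ladder): `θ_g(p) = 0` on `Cay(Γ; S)` for every `p ≤ p_c` and every `CayleyFrm₃`** — INPUT =
(additive unit-range chart with unit steps, finitely generated kernel), no automorphism, no cylinder condition — modulo the universal one-type node
`SamePDropOfSkeletonFrmFrom₁` (OPEN; hypothesis `hN`); Φ2 derived. [cite: BenjaminiSchramm1996, Conj. 4; §2] [cite: KozmaNitzan2024, §1 p. 2 (approach 1)] -/
theorem theta_eq_zero_of_le_of_frmFromNode₁ {p : unitInterval} (hN : SamePDropOfSkeletonFrmFrom₁) (g : Γ)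
    (hp : (p : ℝ) ≤ criticalProb (mulCayley (↑S : Set Γ)) g) : theta (mulCayley (↑S : Set Γ)) g p = 0 := by
  have hc : (mulCayley (S : Set Γ)).Connected := (connected_iff _).2 C.connected_cay
  haveI : Countable Γ := countable_of_connected_of_locallyFinite _ hc g
  have hbase : theta (mulCayley (S : Set Γ)) (1 : Γ) (criticalProbIOf (mulCayley (S : Set Γ)) 1) = 0 :=
    continuity_of_frmFromNode₁ hN _ C.skeletonFrmFrom hc 1 (Finset.mem_singleton_self 1) rfl (C.cylSubcritical_of_le' le_rfl)
  have hθ := theta_iso (leftMulIso S g) (1 : Γ) (criticalProbIOf (mulCayley (S : Set Γ)) 1)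
  have hpc := criticalProb_iso (leftMulIso S g) (1 : Γ)
  rw [leftMulIso_apply, mul_one] at hθ hpc
  have e : criticalProbIOf (mulCayley (S : Set Γ)) g = criticalProbIOf (mulCayley (S : Set Γ)) 1 := Subtype.ext hpc
  have hpc0 : theta (mulCayley (S : Set Γ)) g (criticalProbIOf (mulCayley (S : Set Γ)) g) = 0 := by rw [e, hθ]; exact hbase
  have hmono : theta (mulCayley (S : Set Γ)) g p ≤ theta (mulCayley (S : Set Γ)) g (criticalProbIOf (mulCayley (S : Set Γ)) g) :=
    theta_mono_holds _ _ (Subtype.coe_le_coe.mp hp)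
  have hnn : 0 ≤ theta (mulCayley (S : Set Γ)) g p := MeasureTheory.measureReal_nonneg
  linarith

include C in
/-- **`θ_g(p_c) = 0` on `Cay(Γ; S)` for every `CayleyFrm₃`, modulo the universal node.** [cite: BenjaminiSchramm1996, Conj. 4; §2] -/
theorem criticalContinuity_of_frmFromNode₁ (hN : SamePDropOfSkeletonFrmFrom₁) (g : Γ) :
    theta (mulCayley (↑S : Set Γ)) g (criticalProbIOf (mulCayley (↑S : Set Γ)) g) = 0 :=
  C.theta_eq_zero_of_le_of_frmFromNode₁ hN g le_rfl

/-! ### Constructors -/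

/-- **Every `CayleyNeg₃` is a `CayleyFrm₃`** (drop the automorphism). [folklore] -/
def ofNeg₃ (D : CayleyNeg₃ Γ S) : CayleyFrm₃ Γ S where
  φ := D.φ
  map_mul := D.map_mul
  lip := D.lip
  step := D.step
  r := D.r
  ker_short := D.ker_short

/-- **Every `CayleyFrm₂` is a `CayleyFrm₃`** (connected unit cylinder ⟹ radius `5`). [folklore] -/
def ofFrm₂ (D : CayleyFrm₂ Γ S) : CayleyFrm₃ Γ S where
  φ := D.φ
  map_mul := D.map_mul
  lip := D.lip
  step := D.step
  r := D.cylData₂.r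
  ker_short := D.cylData₂.ker_short

/-- **Constructor from a FINITE GENERATING SET OF THE KERNEL** (`S` generating `Γ`), no automorphism: e.g. every unit-range letters chart of a
finitely generated nilpotent group. [folklore] -/
def ofGens (φ : Γ → Site 2) (map_mul : ∀ g h : Γ, φ (g * h) = φ g + φ h) (lip : ∀ s ∈ S, ∀ i : Fin 2, |φ s i| ≤ 1)
    (step : ∀ i : Fin 2, ∃ s ∈ S, φ s = Pi.single i 1) (hS : Subgroup.closure (S : Set Γ) = ⊤) (T : Finset Γ) (hT0 : ∀ t ∈ T, φ t = 0)
    (hT : ∀ k : Γ, φ k = 0 → k ∈ Subgroup.closure (T : Set Γ)) : CayleyFrm₃ Γ S :=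
  let B : CayCyl.CylBase Γ S :=
    { φ := φ, map_mul := map_mul, lip := lip
      s₀ := Classical.choose (step 0), s₀_mem := (Classical.choose_spec (step 0)).1, φ_s₀ := (Classical.choose_spec (step 0)).2
      s₁ := Classical.choose (step 1), s₁_mem := (Classical.choose_spec (step 1)).1, φ_s₁ := (Classical.choose_spec (step 1)).2 }
  { φ := φ, map_mul := map_mul, lip := lip, step := step
    r := (B.toCylData₂OfGens hS T hT0 hT).r
    ker_short := (B.toCylData₂OfGens hS T hT0 hT).ker_short }

/-- `(ofGens …).φ = φ`. [folklore] -/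
@[simp] theorem ofGens_φ (φ : Γ → Site 2) (map_mul : ∀ g h : Γ, φ (g * h) = φ g + φ h) (lip : ∀ s ∈ S, ∀ i : Fin 2, |φ s i| ≤ 1)
    (step : ∀ i : Fin 2, ∃ s ∈ S, φ s = Pi.single i 1) (hS : Subgroup.closure (S : Set Γ) = ⊤) (T : Finset Γ) (hT0 : ∀ t ∈ T, φ t = 0)
    (hT : ∀ k : Γ, φ k = 0 → k ∈ Subgroup.closure (T : Set Γ)) : (ofGens φ map_mul lip step hS T hT0 hT).φ = φ := rfl

end CayleyFrm₃

end Summit.CriticalPhenomena.PercolationContinuityZ3.Theorems.Transplant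

end
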